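import Summits.QuantumFields.QCD.Theses.HeatSlicedQuarks
import Summits.QuantumFields.QCD.Theorems.HeatSlicedQuarksQuarkLoopCoefficientDefs
import Summits.QuantumFields.QCD.Theorems.HeatSlicedQuarksSmallFieldUltracontractivity

/-!
# Stub `stub_windowBound` of line `Sketch`
(crux `Summit.QuantumFields.QCD.Theses.HeatSlicedQuarks.QuarkLoopCoefficient`, item stmt-QuantumFields-16786)

The a-priori on-site bound in covariantly constant Cartan flux: for an `SU(3)` lattice gauge field
`U` on the four-torus `(ℤ/L)⁴` whose `(0,1)`-plaquettes are `diag(e^{iθ}, e^{−iθ}, 1)` (in the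
fundamental representation) and whose other plaquettes are trivial, every DIAGONAL colour–spin entry
of the massless Wilson heat kernel `K_U(t) = exp(−t D_Wᴴ D_W)` obeys
`|K_U(t)((x,a,α),(x,a,α))| ≤ C/t²` on the whole window `1 ≤ t ≤ L²`, `t|θ| ≤ 1`, with an absolute
constant `C`.

Proof (a corollary of the closed crux 8871 and diagonal monotonicity, no new analysis):
* the plaquette deficit is `3 − Re tr diag(e^{iθ}, e^{−iθ}, 1) = 2(1 − cos θ) ≤ θ²` in the `(0,1)`
  and (by `U_{x;10} = U_{x;01}⁻¹`, `ρ(g⁻¹) = ρ(g)ᴴ`) the `(1,0)` plane, and `0` elsewhere;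
* for `s|θ| ≤ ε/4`, `1 ≤ s ≤ L²`, the radius `r = ⌈√s⌉` has `1 ≤ r ≤ L`, `s ≤ r² ≤ 4s`, hence
  `θ² ≤ (ε/r²)²`, and `SmallFieldUltracontractivity_of` (`m = 0`) gives `|K_U(s)(x,·;x,·)| ≤ C₀/s²`;
* for `ε/4 < t|θ| ≤ 1` the diagonal entry is a nonnegative real (T*T identity), non-increasing in
  `t` (`stub_diagonalMonotone`); from the time `t₀ = ε/(4|θ|) < t`: if `t₀ ≥ 1` the previous step
  at `t₀` gives `≤ C₀/t₀² = 16C₀θ²/ε² ≤ 16C₀/(ε²t²)`; if `t₀ < 1` then `t < 4/ε` and the entry is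
  `≤ 1 ≤ 16/(ε²t²)`.
-/

namespace Summit.QuantumFields.QCD.Cruxes.QuarkLoopCoefficient.Sketch

open Literature.MathematicalPhysics.QuantumLattice Literature.MathematicalPhysics.QuantumFieldTheory
open Literature.Probability.LatticeModels (Site TorusSite)
open Summit.QuantumFields.QCD.Theses.HeatSlicedQuarks
open Summit.QuantumFields.QCD.Theorems.SmallFieldUltracontractivity.Negative
open Summit.QuantumFields.QCD.Cruxes.SmallFieldUltracontractivity.PointCentredAxialParabolic
open Summit.QuantumFields.QCD.Theorems.QuarkLoopCoefficient
open scoped Matrix ComplexConjugate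

namespace WindowBound

/-- The real trace of the Cartan flux plaquette: `Re tr diag(e^{iθ}, e^{−iθ}, 1) = 2 cos θ + 1`. -/
theorem re_trace_fluxDiagonal (θ : ℝ) :
    (Matrix.diagonal ![Complex.exp (Complex.I * θ), Complex.exp (-(Complex.I * θ)), 1]).trace.re =
      2 * Real.cos θ + 1 := by
  rw [Matrix.trace_diagonal, Fin.sum_univ_three]
  simp only [Matrix.cons_val_zero, Matrix.cons_val_one, Matrix.cons_val_two, Matrix.head_cons,
    Matrix.tail_cons, Complex.add_re, Complex.one_re, Complex.exp_re, Complex.neg_re,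
    Complex.neg_im, Complex.mul_re, Complex.mul_im, Complex.I_re, Complex.I_im,
    Complex.ofReal_re, Complex.ofReal_im, zero_mul, one_mul, mul_zero, sub_zero,
    zero_add, Real.exp_zero, neg_zero, Real.cos_neg]
  ring

/-- `2(1 − cos θ) ≤ θ²`, in the form `3 − (2 cos θ + 1) ≤ θ²`. -/
theorem three_sub_re_trace_flux_le (θ : ℝ) : 3 - (2 * Real.cos θ + 1) ≤ θ ^ 2 := by
  have h := Real.one_sub_sq_div_two_le_cos (x := θ)
  linarith

/-- **Plaquette deficit in constant Cartan flux.** If the `(0,1)`-plaquettes of `U` are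
`diag(e^{iθ}, e^{−iθ}, 1)` and all plaquettes outside the `(0,1)`/`(1,0)` orientation are trivial,
then every plaquette deficit is at most `θ²`: `3 − Re tr ρ(U_{y;μν}) ≤ θ²`. -/
theorem deficit_le_sq {L : ℕ} (U : GaugeConfig 4 L (Matrix.specialUnitaryGroup (Fin 3) ℂ)) (θ : ℝ)
    (h01 : ∀ y : TorusSite 4 L, (fundamentalRep (Fin 3)) (plaquetteHolonomy U y 0 1) =
        Matrix.diagonal ![Complex.exp (Complex.I * θ), Complex.exp (-(Complex.I * θ)), 1])
    (hoff : ∀ (y : TorusSite 4 L) (μ ν : Fin 4), ¬(μ = 0 ∧ ν = 1) → ¬(μ = 1 ∧ ν = 0) →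
        plaquetteHolonomy U y μ ν = 1)
    (y : TorusSite 4 L) (μ ν : Fin 4) :
    3 - ((fundamentalRep (Fin 3)) (plaquetteHolonomy U y μ ν)).trace.re ≤ θ ^ 2 := by
  have hre : ((fundamentalRep (Fin 3)) (plaquetteHolonomy U y 0 1)).trace.re = 2 * Real.cos θ + 1 := by
    rw [h01 y, re_trace_fluxDiagonal]
  by_cases h1 : μ = 0 ∧ ν = 1
  · obtain ⟨rfl, rfl⟩ := h1
    rw [hre]
    exact three_sub_re_trace_flux_le θ
  by_cases h2 : μ = 1 ∧ ν = 0
  · obtain ⟨rfl, rfl⟩ := h2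
    -- reversing the orientation inverts the holonomy (group identity), and `ρ(g⁻¹) = ρ(g)ᴴ`
    have hswap : plaquetteHolonomy U y 1 0 = (plaquetteHolonomy U y 0 1)⁻¹ := by
      simp only [plaquetteHolonomy, mul_inv_rev, inv_inv, mul_assoc]
    have hinv : (fundamentalRep (Fin 3)) (plaquetteHolonomy U y 0 1)⁻¹ =
        ((fundamentalRep (Fin 3)) (plaquetteHolonomy U y 0 1))ᴴ := rfl
    rw [hswap, hinv, Matrix.trace_conjTranspose, Complex.star_def, Complex.conj_re, hre]
    exact three_sub_re_trace_flux_le θ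
  · rw [hoff y μ ν h1 h2, map_one, Matrix.trace_one, Fintype.card_fin]
    simp only [Nat.cast_ofNat, Complex.re_ofNat, sub_self]
    exact sq_nonneg θ

/-- **Scale choice for the closed crux 8871.** For `1 ≤ s ≤ L²` the radius `r = ⌈√s⌉` satisfies
`1 ≤ r ≤ L` and `s ≤ r² ≤ 4s`. -/
theorem ceil_sqrt_scale {L : ℕ} {s : ℝ} (hs : 1 ≤ s) (hsL : s ≤ (L : ℝ) ^ 2) :
    1 ≤ ⌈Real.sqrt s⌉₊ ∧ ⌈Real.sqrt s⌉₊ ≤ L ∧ s ≤ ((⌈Real.sqrt s⌉₊ : ℕ) : ℝ) ^ 2 ∧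
      ((⌈Real.sqrt s⌉₊ : ℕ) : ℝ) ^ 2 ≤ 4 * s := by
  have hs0 : 0 ≤ s := by linarith
  have hsqrt1 : 1 ≤ Real.sqrt s := Real.one_le_sqrt.mpr hs
  have hsqrt0 : 0 ≤ Real.sqrt s := Real.sqrt_nonneg s
  refine ⟨?_, ?_, ?_, ?_⟩
  · exact Nat.one_le_ceil_iff.mpr (by linarith)
  · rw [Nat.ceil_le]
    calc Real.sqrt s ≤ Real.sqrt ((L : ℝ) ^ 2) := Real.sqrt_le_sqrt hsL
      _ = L := Real.sqrt_sq (Nat.cast_nonneg L)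
  · have h1 : Real.sqrt s ≤ ⌈Real.sqrt s⌉₊ := Nat.le_ceil _
    calc s = (Real.sqrt s) ^ 2 := (Real.sq_sqrt hs0).symm
      _ ≤ ((⌈Real.sqrt s⌉₊ : ℕ) : ℝ) ^ 2 := pow_le_pow_left₀ hsqrt0 h1 2
  · have h1 : ((⌈Real.sqrt s⌉₊ : ℕ) : ℝ) < Real.sqrt s + 1 := Nat.ceil_lt_add_one hsqrt0
    have h2 : ((⌈Real.sqrt s⌉₊ : ℕ) : ℝ) ≤ 2 * Real.sqrt s := by linarith
    calc ((⌈Real.sqrt s⌉₊ : ℕ) : ℝ) ^ 2 ≤ (2 * Real.sqrt s) ^ 2 :=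
          pow_le_pow_left₀ (Nat.cast_nonneg _) h2 2
      _ = 4 * s := by rw [mul_pow, Real.sq_sqrt hs0]; norm_num

/-- A diagonal heat-kernel entry is a nonnegative real, so its modulus is its real part:
`|exp(−tAᴴA)(i,i)| = Re exp(−tAᴴA)(i,i)` (T*T identity `exp(−tAᴴA)(i,i) = Σ_j |exp(−(t/2)AᴴA)(i,j)|²`). -/
theorem norm_exp_apply_self_eq_re {ι : Type*} [Fintype ι] [DecidableEq ι] (A : Matrix ι ι ℂ)
    (t : ℝ) (i : ι) :
    ‖(NormedSpace.exp (-(t : ℂ) • (Aᴴ * A))) i i‖ = ((NormedSpace.exp (-(t : ℂ) • (Aᴴ * A))) i i).re := by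
  rw [exp_neg_smul_apply_self_eq_sum_norm_sq A t i, ← Complex.ofReal_sum,
    Complex.norm_of_nonneg (Finset.sum_nonneg fun j _ => sq_nonneg _), Complex.ofReal_re]

end WindowBound

open WindowBound in
/-- **Stub `stub_windowBound`** (S/M; worker) of line `Sketch`, crux `QuarkLoopCoefficient`
(item stmt-QuantumFields-16786): `WindowBound` written out.  Under the crux hypotheses (diagonal
links, `(0,1)`-plaquettes `diag(e^{iθ}, e^{−iθ}, 1)`, other plaquettes trivial) every on-site
diagonal colour–spin entry of the massless Wilson heat kernel `torusHeat U t = exp(−t D_Wᴴ D_W)`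
obeys `‖torusHeat U t ((x,a,α),(x,a,α))‖ ≤ C/t²` for `1 ≤ t ≤ L²`, `t|θ| ≤ 1`, with an absolute
constant `C` (`= max C₀ 1 · (16/ε² + 1)` from the constants `ε, C₀` of the closed crux 8871).
Proof: plaquette deficit `≤ θ²` (`deficit_le_sq`); for `t|θ| ≤ ε/4` the closed crux
`SmallFieldUltracontractivity_of` at radius `⌈√t⌉`; for `ε/4 < t|θ| ≤ 1` diagonal monotonicity
(`stub_diagonalMonotone`) from `t₀ = ε/(4|θ|)` (where 8871 applies if `t₀ ≥ 1`, and the entry is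
`≤ 1` with `t < 4/ε` otherwise).  The diagonal-link hypothesis is not used. -/
theorem stub_windowBound :
    (∃ C : ℝ, ∀ (L : ℕ) [NeZero L] (U : GaugeConfig 4 L (Matrix.specialUnitaryGroup (Fin 3) ℂ)) (θ : ℝ),
        (∀ (e : Edge 4 L) (i j : Fin 3), i ≠ j → (fundamentalRep (Fin 3)) (U e) i j = 0) →
        (∀ y : TorusSite 4 L, (fundamentalRep (Fin 3)) (plaquetteHolonomy U y 0 1) =
            Matrix.diagonal ![Complex.exp (Complex.I * θ), Complex.exp (-(Complex.I * θ)), 1]) →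
        (∀ (y : TorusSite 4 L) (μ ν : Fin 4), ¬(μ = 0 ∧ ν = 1) → ¬(μ = 1 ∧ ν = 0) →
            plaquetteHolonomy U y μ ν = 1) →
        ∀ (t : ℝ), 1 ≤ t → t ≤ (L : ℝ) ^ 2 → t * |θ| ≤ 1 →
        ∀ (x : TorusSite 4 L) (a : Fin 3) (α : Fin 4), ‖torusHeat U t (x, a, α) (x, a, α)‖ ≤ C / t ^ 2) := by
  obtain ⟨ε, hε, K, C₀, hC⟩ := (SmallFieldUltracontractivity_of : SmallFieldUltracontractivity)
  refine ⟨max C₀ 1 * (16 / ε ^ 2 + 1), ?_⟩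
  intro L _ U θ _hdiag h01 hoff t ht htL htθ x a α
  -- constants
  set M : ℝ := max C₀ 1 with hM
  have hM1 : 1 ≤ M := le_max_right _ _
  have hMC : C₀ ≤ M := le_max_left _ _
  have hM0 : 0 ≤ M := le_trans zero_le_one hM1
  have hε2 : 0 < ε ^ 2 := by positivity
  have hq : 0 ≤ 16 / ε ^ 2 := by positivity
  have hbA : C₀ ≤ M * (16 / ε ^ 2 + 1) := by nlinarith
  have hbB : 16 * M / ε ^ 2 ≤ M * (16 / ε ^ 2 + 1) := by
    have : 16 * M / ε ^ 2 = M * (16 / ε ^ 2) := by ring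
    nlinarith
  have hbC : 16 / ε ^ 2 ≤ M * (16 / ε ^ 2 + 1) := by nlinarith
  have ht0 : 0 < t := by linarith
  have ht2 : 0 < t ^ 2 := by positivity
  -- plaquette deficit `≤ θ²` everywhere
  have hdef : ∀ (y : TorusSite 4 L) (μ ν : Fin 4),
      3 - ((fundamentalRep (Fin 3)) (plaquetteHolonomy U y μ ν)).trace.re ≤ θ ^ 2 :=
    deficit_le_sq U θ h01 hoff
  -- the engine: the closed crux 8871 at radius `⌈√s⌉` whenever `s|θ| ≤ ε/4`
  have key : ∀ s : ℝ, 1 ≤ s → s ≤ (L : ℝ) ^ 2 → s * |θ| ≤ ε / 4 → ∀ (b : Fin 3) (β : Fin 4),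
      ‖(NormedSpace.exp (-(s : ℂ) • (Matrix.conjTranspose (wilsonDirac (fundamentalRep (Fin 3)) U 0 1) *
        wilsonDirac (fundamentalRep (Fin 3)) U 0 1))) (x, a, α) (x, b, β)‖ ≤ C₀ / s ^ 2 := by
    intro s hs hsL hsθ b β
    obtain ⟨hr1, hrL, hsr, hr4⟩ := ceil_sqrt_scale (L := L) hs hsL
    set r : ℕ := ⌈Real.sqrt s⌉₊ with hr
    have hrpos : (0 : ℝ) < (r : ℝ) ^ 2 := by
      have : (1 : ℝ) ≤ r := by exact_mod_cast hr1
      positivity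
    have hθr : |θ| ≤ ε / (r : ℝ) ^ 2 := by
      rw [le_div_iff₀ hrpos]
      calc |θ| * (r : ℝ) ^ 2 ≤ |θ| * (4 * s) := mul_le_mul_of_nonneg_left hr4 (abs_nonneg θ)
        _ = 4 * (s * |θ|) := by ring
        _ ≤ 4 * (ε / 4) := by linarith
        _ = ε := by ring
    have hsmall : ∀ y : TorusSite 4 L, torusDist x y ≤ K * r → ∀ μ ν : Fin 4,
        3 - ((fundamentalRep (Fin 3)) (plaquetteHolonomy U y μ ν)).trace.re ≤ (ε / (r : ℝ) ^ 2) ^ 2 := by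
      intro y _ μ ν
      refine (hdef y μ ν).trans ?_
      calc θ ^ 2 = |θ| ^ 2 := (sq_abs θ).symm
        _ ≤ (ε / (r : ℝ) ^ 2) ^ 2 := pow_le_pow_left₀ (abs_nonneg θ) hθr 2
    exact hC L U 0 ⟨by norm_num, by norm_num⟩ x r hr1 hrL hsmall s hs hsr a b α β
  -- unfold the abbreviation `torusHeat`
  show ‖(NormedSpace.exp (-(t : ℂ) • (Matrix.conjTranspose (wilsonDirac (fundamentalRep (Fin 3)) U 0 1) *
      wilsonDirac (fundamentalRep (Fin 3)) U 0 1))) (x, a, α) (x, a, α)‖ ≤ M * (16 / ε ^ 2 + 1) / t ^ 2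
  by_cases hcase : t * |θ| ≤ ε / 4
  · -- Case A: the closed crux 8871 applies directly at time `t`
    exact (key t ht htL hcase a α).trans (div_le_div_of_nonneg_right hbA ht2.le)
  · -- Case B: `ε/4 < t|θ| ≤ 1`
    push Not at hcase
    have hθpos : 0 < |θ| := by
      rcases (abs_nonneg θ).lt_or_eq with h | h
      · exact h
      · rw [← h, mul_zero] at hcase
        linarith
    have hθt : θ ^ 2 ≤ 1 / t ^ 2 := by
      rw [le_div_iff₀ ht2, ← sq_abs, ← mul_pow]
      have h0 : 0 ≤ |θ| * t := by positivity
      have h1 : |θ| * t ≤ 1 := by rw [mul_comm]; exact htθ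
      calc (|θ| * t) ^ 2 ≤ 1 ^ 2 := pow_le_pow_left₀ h0 h1 2
        _ = 1 := one_pow 2
    set A := wilsonDirac (fundamentalRep (Fin 3)) U 0 1 with hA
    have hreal := norm_exp_apply_self_eq_re A t (x, a, α)
    set t₀ : ℝ := ε / (4 * |θ|) with ht₀
    have ht₀θ : t₀ * |θ| = ε / 4 := by
      rw [ht₀]
      field_simp
    have ht₀t : t₀ < t := by
      rw [ht₀, div_lt_iff₀ (by positivity)]
      linarith
    have ht₀pos : 0 < t₀ := by rw [ht₀]; positivity
    by_cases h1t₀ : 1 ≤ t₀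
    · -- Case B1: 8871 at time `t₀ ≥ 1`, then diagonal monotonicity `t₀ ≤ t`
      have hK₀ := key t₀ h1t₀ (by linarith) ht₀θ.le a α
      have hmono := stub_diagonalMonotone _ A (x, a, α) t₀ t ht₀pos.le ht₀t.le
      have hC₀ : 0 ≤ C₀ := by
        have h := (norm_nonneg _).trans hK₀
        have ht₀2 : 0 < t₀ ^ 2 := by positivity
        rwa [le_div_iff₀ ht₀2, zero_mul] at h
      have ht₀sq : C₀ / t₀ ^ 2 = 16 * C₀ * θ ^ 2 / ε ^ 2 := by
        rw [ht₀, ← sq_abs θ]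
        field_simp
        ring
      calc ‖(NormedSpace.exp (-(t : ℂ) • (Aᴴ * A))) (x, a, α) (x, a, α)‖
          = ((NormedSpace.exp (-(t : ℂ) • (Aᴴ * A))) (x, a, α) (x, a, α)).re := hreal
        _ ≤ ((NormedSpace.exp (-(t₀ : ℂ) • (Aᴴ * A))) (x, a, α) (x, a, α)).re := hmono
        _ ≤ ‖(NormedSpace.exp (-(t₀ : ℂ) • (Aᴴ * A))) (x, a, α) (x, a, α)‖ := Complex.re_le_norm _
        _ ≤ C₀ / t₀ ^ 2 := hK₀
        _ = 16 * C₀ * θ ^ 2 / ε ^ 2 := ht₀sq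
        _ ≤ 16 * C₀ * (1 / t ^ 2) / ε ^ 2 := by
          apply div_le_div_of_nonneg_right _ hε2.le
          exact mul_le_mul_of_nonneg_left hθt (by positivity)
        _ = (16 * C₀ / ε ^ 2) / t ^ 2 := by ring
        _ ≤ (16 * M / ε ^ 2) / t ^ 2 := by
          apply div_le_div_of_nonneg_right _ ht2.le
          apply div_le_div_of_nonneg_right _ hε2.le
          linarith
        _ ≤ M * (16 / ε ^ 2 + 1) / t ^ 2 := div_le_div_of_nonneg_right hbB ht2.le
    · -- Case B2: `t₀ < 1`, i.e. `|θ| > ε/4`, so `t < 4/ε` and the entry is `≤ 1 ≤ 16/(ε²t²)`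
      push Not at h1t₀
      have hεθ : ε < 4 * |θ| := by
        rw [ht₀, div_lt_one (by positivity)] at h1t₀
        exact h1t₀
      have ht4 : t * ε < 4 := by nlinarith
      have hone : (1 : ℝ) ≤ 16 / ε ^ 2 / t ^ 2 := by
        rw [div_div, one_le_div (by positivity), ← mul_pow]
        have h0 : 0 ≤ ε * t := by positivity
        have h1 : ε * t ≤ 4 := by linarith [mul_comm ε t]
        calc (ε * t) ^ 2 ≤ 4 ^ 2 := pow_le_pow_left₀ h0 h1 2
          _ = 16 := by norm_num
      calc ‖(NormedSpace.exp (-(t : ℂ) • (Aᴴ * A))) (x, a, α) (x, a, α)‖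
          ≤ 1 := norm_exp_neg_smul_conjTranspose_mul_self_apply_le_one A ht0.le _ _
        _ ≤ 16 / ε ^ 2 / t ^ 2 := hone
        _ ≤ M * (16 / ε ^ 2 + 1) / t ^ 2 := div_le_div_of_nonneg_right hbC ht2.le

end Summit.QuantumFields.QCD.Cruxes.QuarkLoopCoefficient.Sketch
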